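import Summits.QuantumFields.YangMills.Theorems.IR.VacuumEscapeSpectralSeamTrace
import HarnessLib

/-!
# Line `vacuum_escape` (crux `BalabanLadder.IR`, stmt-QuantumFields-19354) — spectral seam, part 2/3:
# the trace cluster bound with the thermal term at TOTAL time

Helper toward the registered stub `stub_spectralSeam : SliceGapInUnits ∧ ColdPurity ⇒ GapInUnits` of
`Cruxes/IR/Lines/vacuum_escape.lean` (ideator ym-ir-idea-8; pooled prover ym-ir-line-pool-p3).  Finite-dimensional model
(`T ≥ 0` on `ℝᵈ`, unit fixed vector `Ω`, contraction rate `r` on `Ω^⊥`, `P = |Ω⟩⟨Ω|`, `Z = tr Tᴺ`):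

  `|tr(Tᵃ A Tᵇ B)/Z − (tr(Tᵖ A)/Z)(tr(Tᵠ B)/Z)| ≤ ‖A‖‖B‖ (rᵇ + rᵃ + 2·Xab + XN + Xp + Xq + Xp·Xq)`   (`a, b ≥ 1`)

whenever `tr T^{a+b} − 1 ≤ Xab`, `tr Tᴺ − 1 ≤ XN`, `tr Tᵖ − 1 ≤ Xp`, `tr Tᵠ − 1 ≤ Xq` (`traceCluster_total`).  It is the tree's
`TraceNormColdPressure.stub_traceCluster` with the thermal double sum `tr((Tᵃ−P)A(Tᵇ−P)B)` bounded by `2‖A‖‖B‖(tr T^{a+b} − 1)`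
(part 1, `abs_trace_remainder_mul_le`) instead of `rᵇ‖A‖‖B‖(tr Tᵃ − 1)`: on the symmetric torus `P = 2S+1` the total time
`a + b = P − 2w` stays `≥ S + 1` for every separation `n ≤ S`, which is where the thermal face `ColdPurity` is stated.
Finite-dimensional linear algebra [folklore]; no Yang–Mills content.  HONEST FRAMING: plumbing for one format seam of one line of
an open crux of a CONDITIONAL chain; nothing here bears on the Yang–Mills mass gap (Clay); R4 closes only `BalabanLadder.UV`.
-/

noncomputable section

open scoped BigOperators InnerProductSpace
open InnerProductSpace
open Summit.QuantumFields.YangMills.Theorems.WeakCouplingHypercubicLimit.TraceNormColdPressure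
  (stub_traceHolder toolkit_powSubRankOne abs_real_inner_apply_le_opNorm trace_rankOne_mul_eq trace_pow_sub_rankOne_eq)

namespace Summit.QuantumFields.YangMills.Cruxes.IR.VacuumEscape.SpectralSeam

section RealBookkeeping

/-- Scalar bookkeeping: with `Z = 1 + xN ≥ 1`, `u = αβ + e₁ + e₂ + e₃`, `s_A = α + e_A`, `s_B = β + e_B` and the stated
bounds on the pieces, `|u/Z − (s_A/Z)(s_B/Z)| ≤ n_A n_B (r_b + r_a + 2 Xab + XN + Xp + Xq + Xp Xq)`. [folklore] -/
theorem real_bookkeeping_total (α β e1 e2 e3 eA eB xab xN xp xq Xab XN Xp Xq nA nB ra rb : ℝ)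
    (hnA : 0 ≤ nA) (hnB : 0 ≤ nB) (hra : 0 ≤ ra) (hrb : 0 ≤ rb)
    (hxab0 : 0 ≤ xab) (hxN0 : 0 ≤ xN) (hxp0 : 0 ≤ xp) (hxq0 : 0 ≤ xq)
    (hXab : xab ≤ Xab) (hXN : xN ≤ XN) (hXp : xp ≤ Xp) (hXq : xq ≤ Xq)
    (hα : |α| ≤ nA) (hβ : |β| ≤ nB) (he1 : |e1| ≤ nA * rb * nB) (he2 : |e2| ≤ nB * ra * nA)
    (he3 : |e3| ≤ 2 * nA * nB * xab) (heA : |eA| ≤ xp * nA) (heB : |eB| ≤ xq * nB) :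
    |(α * β + e1 + e2 + e3) / (1 + xN) - (α + eA) / (1 + xN) * ((β + eB) / (1 + xN))| ≤
      nA * nB * (rb + ra + 2 * Xab + XN + Xp + Xq + Xp * Xq) := by
  have hZ1 : (1 : ℝ) ≤ 1 + xN := by linarith
  have hZ0 : (0 : ℝ) < 1 + xN := by linarith
  have key : (α * β + e1 + e2 + e3) / (1 + xN) - (α + eA) / (1 + xN) * ((β + eB) / (1 + xN)) =
      (xN * (α * β) + (1 + xN) * (e1 + e2 + e3) - α * eB - β * eA - eA * eB) / (1 + xN) ^ 2 := by
    field_simp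
    ring
  rw [key, abs_div, abs_of_pos (by positivity : (0 : ℝ) < (1 + xN) ^ 2), div_le_iff₀ (by positivity)]
  have hαβ : |α| * |β| ≤ nA * nB := mul_le_mul hα hβ (abs_nonneg _) hnA
  have h1 : |xN * (α * β)| ≤ xN * (nA * nB) := by
    rw [abs_mul, abs_of_nonneg hxN0, abs_mul]
    exact mul_le_mul_of_nonneg_left hαβ hxN0
  have h2 : |(1 + xN) * (e1 + e2 + e3)| ≤
      (1 + xN) * (nA * rb * nB + nB * ra * nA + 2 * nA * nB * xab) := by
    rw [abs_mul, abs_of_pos hZ0]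
    refine mul_le_mul_of_nonneg_left ?_ hZ0.le
    exact ((abs_add_le _ _).trans (add_le_add (abs_add_le _ _) le_rfl)).trans
      (add_le_add (add_le_add he1 he2) he3)
  have h3 : |α * eB| ≤ nA * (xq * nB) := by
    rw [abs_mul]; exact mul_le_mul hα heB (abs_nonneg _) hnA
  have h4 : |β * eA| ≤ nB * (xp * nA) := by
    rw [abs_mul]; exact mul_le_mul hβ heA (abs_nonneg _) hnB
  have h5 : |eA * eB| ≤ xp * nA * (xq * nB) := by
    rw [abs_mul]; exact mul_le_mul heA heB (abs_nonneg _) (by positivity)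
  have hnum : |xN * (α * β) + (1 + xN) * (e1 + e2 + e3) - α * eB - β * eA - eA * eB| ≤
      xN * (nA * nB) + (1 + xN) * (nA * rb * nB + nB * ra * nA + 2 * nA * nB * xab) +
        nA * (xq * nB) + nB * (xp * nA) + xp * nA * (xq * nB) := by
    calc |xN * (α * β) + (1 + xN) * (e1 + e2 + e3) - α * eB - β * eA - eA * eB|
        ≤ |xN * (α * β) + (1 + xN) * (e1 + e2 + e3) - α * eB - β * eA| + |eA * eB| :=
          abs_sub _ _
      _ ≤ |xN * (α * β) + (1 + xN) * (e1 + e2 + e3) - α * eB| + |β * eA| + |eA * eB| := by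
          gcongr; exact abs_sub _ _
      _ ≤ |xN * (α * β) + (1 + xN) * (e1 + e2 + e3)| + |α * eB| + |β * eA| + |eA * eB| := by
          gcongr; exact abs_sub _ _
      _ ≤ |xN * (α * β)| + |(1 + xN) * (e1 + e2 + e3)| + |α * eB| + |β * eA| + |eA * eB| := by
          gcongr; exact abs_add_le _ _
      _ ≤ _ := by linarith [h1, h2, h3, h4, h5]
  have hW1 : 0 ≤ xN * (nA * nB) + nA * (xq * nB) + nB * (xp * nA) + xp * nA * (xq * nB) := by
    positivity
  have hW2 : 0 ≤ nA * rb * nB + nB * ra * nA + 2 * nA * nB * xab := by positivity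
  have hmono : nA * nB * (rb + ra + 2 * xab + xN + xp + xq + xp * xq) ≤
      nA * nB * (rb + ra + 2 * Xab + XN + Xp + Xq + Xp * Xq) := by
    have hpq : xp * xq ≤ Xp * Xq := mul_le_mul hXp hXq hxq0 (hxp0.trans hXp)
    exact mul_le_mul_of_nonneg_left (by linarith) (mul_nonneg hnA hnB)
  have hZ2 : (1 + xN : ℝ) ≤ (1 + xN) ^ 2 := by
    calc (1 + xN : ℝ) = (1 + xN) * 1 := (mul_one _).symm
      _ ≤ (1 + xN) * (1 + xN) := mul_le_mul_of_nonneg_left hZ1 hZ0.le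
      _ = (1 + xN) ^ 2 := (sq _).symm
  have hZsq1 : (1 : ℝ) ≤ (1 + xN) ^ 2 := hZ1.trans hZ2
  calc |xN * (α * β) + (1 + xN) * (e1 + e2 + e3) - α * eB - β * eA - eA * eB|
      ≤ xN * (nA * nB) + (1 + xN) * (nA * rb * nB + nB * ra * nA + 2 * nA * nB * xab) +
        nA * (xq * nB) + nB * (xp * nA) + xp * nA * (xq * nB) := hnum
    _ = (xN * (nA * nB) + nA * (xq * nB) + nB * (xp * nA) + xp * nA * (xq * nB)) +
        (1 + xN) * (nA * rb * nB + nB * ra * nA + 2 * nA * nB * xab) := by ring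
    _ ≤ (1 + xN) ^ 2 * (xN * (nA * nB) + nA * (xq * nB) + nB * (xp * nA) + xp * nA * (xq * nB)) +
        (1 + xN) ^ 2 * (nA * rb * nB + nB * ra * nA + 2 * nA * nB * xab) :=
        add_le_add (le_mul_of_one_le_left hW1 hZsq1) (mul_le_mul_of_nonneg_right hZ2 hW2)
    _ = nA * nB * (rb + ra + 2 * xab + xN + xp + xq + xp * xq) * (1 + xN) ^ 2 := by ring
    _ ≤ nA * nB * (rb + ra + 2 * Xab + XN + Xp + Xq + Xp * Xq) * (1 + xN) ^ 2 :=
        mul_le_mul_of_nonneg_right hmono (by positivity)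

end RealBookkeeping

section Main

/-- **Trace cluster bound with the thermal term at total time** (`a, b ≥ 1`): for `T ≥ 0` on `ℝᵈ` with `T Ω = Ω`,
`‖Ω‖ = 1`, `‖T v‖ ≤ r‖v‖` on `Ω^⊥` (`r ≥ 0`), and trace-excess bounds `tr T^{a+b} − 1 ≤ Xab`, `tr Tᴺ − 1 ≤ XN`,
`tr Tᵖ − 1 ≤ Xp`, `tr Tᵠ − 1 ≤ Xq`, with `Z := tr Tᴺ`:
`|tr(Tᵃ A Tᵇ B)/Z − (tr(Tᵖ A)/Z)(tr(Tᵠ B)/Z)| ≤ ‖A‖‖B‖ (rᵇ + rᵃ + 2 Xab + XN + Xp + Xq + Xp·Xq)`.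
Proof: `Tᵐ = P + R_m`, `R_m ≥ 0`, `‖R_m‖ ≤ rᵐ`, `tr R_m = tr Tᵐ − 1`; expand; the term `tr(R_a A R_b B)` is bounded by
`abs_trace_remainder_mul_le`, the others as in `stub_traceCluster`. [folklore] -/
theorem traceCluster_total :
    ∀ (d : ℕ) (T A B : EuclideanSpace ℝ (Fin d) →L[ℝ] EuclideanSpace ℝ (Fin d)) (Ω : EuclideanSpace ℝ (Fin d))
      (r Xab XN Xp Xq : ℝ) (a b p q N : ℕ),
      T.IsPositive → ‖Ω‖ = 1 → T Ω = Ω → 0 ≤ r →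
      (∀ v, inner ℝ Ω v = 0 → ‖T v‖ ≤ r * ‖v‖) → 1 ≤ a → 1 ≤ b →
      LinearMap.trace ℝ _ (↑(T ^ (a + b)) : EuclideanSpace ℝ (Fin d) →ₗ[ℝ] EuclideanSpace ℝ (Fin d)) - 1 ≤ Xab →
      LinearMap.trace ℝ _ (↑(T ^ N) : EuclideanSpace ℝ (Fin d) →ₗ[ℝ] EuclideanSpace ℝ (Fin d)) - 1 ≤ XN →
      LinearMap.trace ℝ _ (↑(T ^ p) : EuclideanSpace ℝ (Fin d) →ₗ[ℝ] EuclideanSpace ℝ (Fin d)) - 1 ≤ Xp →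
      LinearMap.trace ℝ _ (↑(T ^ q) : EuclideanSpace ℝ (Fin d) →ₗ[ℝ] EuclideanSpace ℝ (Fin d)) - 1 ≤ Xq →
      |LinearMap.trace ℝ _ (↑(T ^ a * A * T ^ b * B) : EuclideanSpace ℝ (Fin d) →ₗ[ℝ] EuclideanSpace ℝ (Fin d)) /
            LinearMap.trace ℝ _ (↑(T ^ N) : EuclideanSpace ℝ (Fin d) →ₗ[ℝ] EuclideanSpace ℝ (Fin d)) -
          LinearMap.trace ℝ _ (↑(T ^ p * A) : EuclideanSpace ℝ (Fin d) →ₗ[ℝ] EuclideanSpace ℝ (Fin d)) /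
              LinearMap.trace ℝ _ (↑(T ^ N) : EuclideanSpace ℝ (Fin d) →ₗ[ℝ] EuclideanSpace ℝ (Fin d)) *
            (LinearMap.trace ℝ _ (↑(T ^ q * B) : EuclideanSpace ℝ (Fin d) →ₗ[ℝ] EuclideanSpace ℝ (Fin d)) /
              LinearMap.trace ℝ _ (↑(T ^ N) : EuclideanSpace ℝ (Fin d) →ₗ[ℝ] EuclideanSpace ℝ (Fin d)))| ≤
        ‖A‖ * ‖B‖ * (r ^ b + r ^ a + 2 * Xab + XN + Xp + Xq + Xp * Xq) := by
  intro d T A B Ω r Xab XN Xp Xq a b p q N hT hΩ hTΩ hr0 hcon ha hb hXab hXN hXp hXq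
  -- notation: `P = |Ω⟩⟨Ω|`, `τ = tr`
  set P : EuclideanSpace ℝ (Fin d) →L[ℝ] EuclideanSpace ℝ (Fin d) := rankOne ℝ Ω Ω with hPdef
  have hdec : ∀ m : ℕ, T ^ m = P + (T ^ m - P) := fun m => by abel
  set τ : (EuclideanSpace ℝ (Fin d) →L[ℝ] EuclideanSpace ℝ (Fin d)) → ℝ :=
    fun M => LinearMap.trace ℝ _ (↑M : EuclideanSpace ℝ (Fin d) →ₗ[ℝ] EuclideanSpace ℝ (Fin d)) with hτ
  have τ_add : ∀ M M', τ (M + M') = τ M + τ M' := fun M M' => by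
    simp only [hτ, ContinuousLinearMap.toLinearMap_add, map_add]
  have τ_comm : ∀ M M' : EuclideanSpace ℝ (Fin d) →L[ℝ] EuclideanSpace ℝ (Fin d),
      τ (M * M') = τ (M' * M) := fun M M' => by
    simp only [hτ]
    rw [ContinuousLinearMap.toLinearMap_mul, LinearMap.trace_mul_comm,
      ← ContinuousLinearMap.toLinearMap_mul]
  have τ_P_mul : ∀ M : EuclideanSpace ℝ (Fin d) →L[ℝ] EuclideanSpace ℝ (Fin d),
      τ (P * M) = inner ℝ Ω (M Ω) := fun M => trace_rankOne_mul_eq M Ω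
  -- positivity, trace excesses, norms of the remainders `Tᵐ − P`
  have htk : ∀ m : ℕ, (T ^ m - P).IsPositive ∧ ‖T ^ m - P‖ ≤ r ^ m ∧ τ (T ^ m - P) = τ (T ^ m) - 1 :=
    fun m => toolkit_powSubRankOne d T Ω r m hT hΩ hTΩ hr0 hcon
  have hRpos : ∀ m : ℕ, (T ^ m - P).IsPositive := fun m => (htk m).1
  have hx : ∀ m : ℕ, τ (T ^ m - P) = τ (T ^ m) - 1 := fun m => (htk m).2.2
  have hx0 : ∀ m : ℕ, 0 ≤ τ (T ^ m - P) := fun m => (hRpos m).toLinearMap.trace_nonneg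
  have hRn : ∀ m : ℕ, ‖T ^ m - P‖ ≤ r ^ m := fun m => (htk m).2.1
  -- the pieces
  have hα : |inner ℝ Ω (A Ω)| ≤ ‖A‖ := abs_real_inner_apply_le_opNorm A hΩ
  have hβ : |inner ℝ Ω (B Ω)| ≤ ‖B‖ := abs_real_inner_apply_le_opNorm B hΩ
  have hARB : ‖A * (T ^ b - P) * B‖ ≤ ‖A‖ * r ^ b * ‖B‖ := by
    calc ‖A * (T ^ b - P) * B‖ ≤ ‖A * (T ^ b - P)‖ * ‖B‖ := norm_mul_le _ _
      _ ≤ ‖A‖ * ‖T ^ b - P‖ * ‖B‖ := by gcongr; exact norm_mul_le _ _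
      _ ≤ ‖A‖ * r ^ b * ‖B‖ := by gcongr; exact hRn b
  have hBRA : ‖B * (T ^ a - P) * A‖ ≤ ‖B‖ * r ^ a * ‖A‖ := by
    calc ‖B * (T ^ a - P) * A‖ ≤ ‖B * (T ^ a - P)‖ * ‖A‖ := norm_mul_le _ _
      _ ≤ ‖B‖ * ‖T ^ a - P‖ * ‖A‖ := by gcongr; exact norm_mul_le _ _
      _ ≤ ‖B‖ * r ^ a * ‖A‖ := by gcongr; exact hRn a
  have he1 : |inner ℝ Ω ((A * (T ^ b - P) * B) Ω)| ≤ ‖A‖ * r ^ b * ‖B‖ :=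
    (abs_real_inner_apply_le_opNorm _ hΩ).trans hARB
  have he2 : |inner ℝ Ω ((B * (T ^ a - P) * A) Ω)| ≤ ‖B‖ * r ^ a * ‖A‖ :=
    (abs_real_inner_apply_le_opNorm _ hΩ).trans hBRA
  have he3 : |τ ((T ^ a - P) * (A * (T ^ b - P) * B))| ≤ 2 * ‖A‖ * ‖B‖ * τ (T ^ (a + b) - P) := by
    rw [hx (a + b)]
    exact abs_trace_remainder_mul_le T A B Ω hT hΩ hTΩ hr0 hcon ha hb
  have heA : |τ ((T ^ p - P) * A)| ≤ τ (T ^ p - P) * ‖A‖ := stub_traceHolder d _ _ (hRpos p)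
  have heB : |τ ((T ^ q - P) * B)| ≤ τ (T ^ q - P) * ‖B‖ := stub_traceHolder d _ _ (hRpos q)
  -- the identities
  have hu : τ (T ^ a * A * T ^ b * B) = inner ℝ Ω (A Ω) * inner ℝ Ω (B Ω) +
      inner ℝ Ω ((A * (T ^ b - P) * B) Ω) + inner ℝ Ω ((B * (T ^ a - P) * A) Ω) +
      τ ((T ^ a - P) * (A * (T ^ b - P) * B)) := by
    have e : T ^ a * A * T ^ b * B = P * (A * P * B) + P * (A * (T ^ b - P) * B) +
        (T ^ a - P) * A * (P * B) + (T ^ a - P) * (A * (T ^ b - P) * B) := by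
      conv_lhs => rw [hdec a, hdec b]
      noncomm_ring
    have hPAPB : τ (P * (A * P * B)) = inner ℝ Ω (A Ω) * inner ℝ Ω (B Ω) := by
      rw [τ_P_mul, mul_apply_eq_comp, mul_apply_eq_comp]
      simp only [hPdef, rankOne_apply, map_smul, real_inner_smul_right]
      ring
    rw [e, τ_add, τ_add, τ_add, hPAPB, τ_P_mul, τ_comm ((T ^ a - P) * A) (P * B),
      mul_assoc P B, τ_P_mul, ← mul_assoc]
  have hsA : τ (T ^ p * A) = inner ℝ Ω (A Ω) + τ ((T ^ p - P) * A) := by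
    conv_lhs => rw [hdec p]
    rw [add_mul, τ_add, τ_P_mul]
  have hsB : τ (T ^ q * B) = inner ℝ Ω (B Ω) + τ ((T ^ q - P) * B) := by
    conv_lhs => rw [hdec q]
    rw [add_mul, τ_add, τ_P_mul]
  have hZ : τ (T ^ N) = 1 + τ (T ^ N - P) := by rw [hx N]; ring
  -- assemble
  change |τ (T ^ a * A * T ^ b * B) / τ (T ^ N) - τ (T ^ p * A) / τ (T ^ N) * (τ (T ^ q * B) / τ (T ^ N))|
    ≤ ‖A‖ * ‖B‖ * (r ^ b + r ^ a + 2 * Xab + XN + Xp + Xq + Xp * Xq)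
  rw [hu, hsA, hsB, hZ]
  change τ (T ^ (a + b)) - 1 ≤ Xab at hXab
  change τ (T ^ N) - 1 ≤ XN at hXN
  change τ (T ^ p) - 1 ≤ Xp at hXp
  change τ (T ^ q) - 1 ≤ Xq at hXq
  rw [← hx] at hXab hXN hXp hXq
  have he3' : |τ ((T ^ a - P) * (A * (T ^ b - P) * B))| ≤ 2 * ‖A‖ * ‖B‖ * τ (T ^ (a + b) - P) := he3
  exact real_bookkeeping_total _ _ _ _ _ _ _ _ _ _ _ Xab XN Xp Xq ‖A‖ ‖B‖ (r ^ a) (r ^ b)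
    (norm_nonneg _) (norm_nonneg _) (pow_nonneg hr0 _) (pow_nonneg hr0 _)
    (hx0 (a + b)) (hx0 N) (hx0 p) (hx0 q) hXab hXN hXp hXq hα hβ he1 he2 he3' heA heB

end Main

end Summit.QuantumFields.YangMills.Cruxes.IR.VacuumEscape.SpectralSeam

end
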